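import Mathlib
import Literature.NumberTheory.LFunctions.Zhang2022.TypedSection15E
import Literature.NumberTheory.LFunctions.Zhang2022.Section15Eval1524Generic
import Literature.NumberTheory.LFunctions.Zhang2022.Section15U056RateRel
import Literature.NumberTheory.LFunctions.Zhang2022.AppendixBLemma151AssemblyGeneric
import Literature.NumberTheory.LFunctions.Zhang2022.AppendixBLemma151Reduction
import HarnessLib

/-!
# Zhang (2022) §15, RT-05 E-chain: the NAMED E-twin edges (`Eq15_22E → Eq15_23RE`,
# Lemma 15.1 χ/χR at 𝔢ⱼ := `frakeE e1pp j`) — one-line instances of the generic theorems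

Topic `Literature/NumberTheory/LFunctions/Zhang2022` (Landau–Siegel audit tree; verdict-neutral).
Y. Zhang, *Discrete mean estimates and the Landau–Siegel zero*, arXiv:2211.02515v1 (2022)
[Zhang2022LandauSiegel] — an unrefereed manuscript under adjudication; nothing here asserts or denies
its Theorems 1–2. Lane ZHANG-L, RE-TYPE RT-05 (zl-lead R-22/R-28; zl-ref-chief C1–C5): instances at
`e := frakeE e1pp` / `E1 := e1jE e1pp` of `Section15Eval1524Generic` and
`AppendixBLemma151AssemblyGeneric`, stated with the E-twin NAMES of `TypedSection15E`
(`Typed.Section15C.Eq15_22E/Eq15_23RE`, `Skeleton.Lemma151ChiE/ChiRE`), for the skeleton's E-chain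
(zl-skel) and the h15_22 assembler (zl-w15-p5). At `e1pp := e1ppj` these are the printed edges
(`rfl` bridges of `TypedSection15E`/`Section18DefsE`); at `e1pp := AppendixB.e1ppD` they are the
chain of record (DERIVED `e″₁ⱼ = −jπi·b*`). Theorems only; no new claims. WHAT THIS IS NOT: a proof
of (15.22), of Lemma 15.1's App.-B parts, or of anything about Theorems 1–2 / Landau–Siegel zeros.

## References
* Y. Zhang, arXiv:2211.02515v1 (2022), §15 Lemma 15.1 p. 86, (15.22)–(15.24) pp. 87–88; App. B
  pp. 106–108. [cite: Zhang2022LandauSiegel, §15 pp. 86–88]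
-/

noncomputable section

open Complex Real ComplexConjugate
open Literature.NumberTheory.LFunctions.Zhang2022.Skeleton
open Literature.NumberTheory.LFunctions.Zhang2022.Typed

/-! ## (15.22)E + u056-rate ⇒ (15.23)ᴿE ; (15.24) with 𝔢ⱼ := frakeE e1pp j -/

namespace Literature.NumberTheory.LFunctions.Zhang2022.Ded1524

/-- **`Eq15_22E e1pp c′ X` and u056 at the rate `O(1/𝓛)` give `Eq15_23RE e1pp c′ X`** (any `e1pp`,
any instantiation `X`): `eq15_23_of_eq15_22_rate1_gen` at `e := frakeE e1pp`.
[cite: Zhang2022LandauSiegel, §15 (15.23) p.88] -/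
theorem eq15_23RE_of_eq15_22E_rate1 (e1pp : ℕ → ℂ) (c' : ℝ) (X : Section15C.Inputs15AB)
    (h22 : Section15C.Eq15_22E e1pp c' X)
    (h56 : ∃ C : ℝ, ForAllLarge fun D _ χ => AssumptionA D χ → ∀ j ∈ ({1, 2, 3} : Finset ℕ),
      ‖X.calM1 c' χ 1 1 (1 - betaJ c' D j) * Section15C.sumInN c' X χ j -
        (frakA χ : ℂ) * (Nat.totient D : ℂ) / (D : ℂ)‖ ≤ C / ell D) :
    Section15C.Eq15_23RE e1pp c' X :=
  eq15_23_of_eq15_22_rate1_gen (frakeE e1pp) c' X h22 h56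

/-- **(15.23)ᴿE at the landed instance `inputs15AB` from (15.22)E and the five 𝔢-free companions
u050, Lemma 15.2, `Lemma153Rp`, u055Rel, u035** (twin of `eq15_23R_of_partsRel` for the E-chain). [cite: Zhang2022LandauSiegel, §15 (15.23) p.88] -/
theorem eq15_23RE_of_partsRel (e1pp : ℕ → ℂ) (c' : ℝ)
    (h22 : Section15C.Eq15_22E e1pp c' Section15C.inputs15AB)
    (h50 : Section15C.Step15_u050 c' Section15C.inputs15AB)
    (h152 : Section15C.Lemma152 c' Section15C.inputs15AB)
    (h153 : Section15C.Lemma153Rp c' Section15C.inputs15AB)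
    (h55 : Section15C.Step15_u055Rel c' Section15C.inputs15AB)
    (h35 : Section15B.Step15_u035 c') : Section15C.Eq15_23RE e1pp c' Section15C.inputs15AB :=
  eq15_23RE_of_eq15_22E_rate1 e1pp c' _ h22 (u056_rate1_of_partsRel c' h50 h152 h153 h55 h35)

/-- **(15.24) with 𝔢ⱼ := `frakeE e1pp j`** from (15.6), (15.17) (coefficient reading `b`, as
parameters `Φp`, `S`), (15.23)ᴿE and `ℛ₁*ℛ₁ⱼ = (1,2,1) + O(𝓛⁻⁵)` — `eval1524_of_rates_R_gen` at
`e := frakeE e1pp`, conclusion = the body of `Skeleton.Eval1524` with `frakeE e1pp` (the skeleton's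
`Eval1524E e1pp c′`, zl-skel's `SkeletonEvalRelE`, is this body). [cite: Zhang2022LandauSiegel, §15 (15.24) p.88] -/
theorem eval1524E_of_rates_R (e1pp : ℕ → ℂ) {c' : ℝ}
    {Φp S R : ∀ (D : ℕ) [NeZero D], DirichletCharacter ℂ D → ℕ → ℂ}
    {Rs : ∀ (D : ℕ) [NeZero D], DirichletCharacter ℂ D → ℂ}
    (h6 : ∀ ε : ℝ, 0 < ε → ForAllLarge fun D _ χ => AssumptionA D χ →
      ‖Phi1 c' χ - ∑ p ∈ primeWindow D, Φp D χ p‖ ≤ ε * frakP D)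
    (h17 : ∀ ε : ℝ, 0 < ε → ForAllLarge fun D _ χ => AssumptionA D χ → ∀ p ∈ primeWindow D,
      ‖Φp D χ p - Rs D χ * (D : ℂ) * (p : ℂ) / (Nat.totient D : ℂ) *
          ∑ j ∈ ({1, 2, 3} : Finset ℕ), R D χ j * S D χ j‖ ≤ ε * p)
    (h23RE : ∃ C : ℝ, ForAllLarge fun D _ χ => AssumptionA D χ → ∀ j ∈ ({1, 2, 3} : Finset ℕ),
      ‖S D χ j - frakeE e1pp j * (frakA χ : ℂ) * (Nat.totient D : ℂ) / (D : ℂ)‖ ≤ C / ell D)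
    (hprod : ∃ C : ℝ, ForAllLarge fun D _ χ => AssumptionA D χ →
      ‖Rs D χ * R D χ 1 - 1‖ ≤ C / ell D ^ 5 ∧ ‖Rs D χ * R D χ 2 - 2‖ ≤ C / ell D ^ 5 ∧
        ‖Rs D χ * R D χ 3 - 1‖ ≤ C / ell D ^ 5) :
    ∀ ε : ℝ, 0 < ε → ForAllLarge fun D _ χ => AssumptionA D χ →
      ‖Phi1 c' χ - (frakeE e1pp 1 + 2 * frakeE e1pp 2 + frakeE e1pp 3) * frakA χ * frakP D‖ ≤
        ε * frakP D :=
  eval1524_of_rates_R_gen (frakeE e1pp) h6 h17 h23RE hprod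

end Literature.NumberTheory.LFunctions.Zhang2022.Ded1524

/-! ## Lemma 15.1 χ/χR with 𝔢ⱼ := frakeE e1pp j from the App.-B parts at μ₁-value `e1jE e1pp` -/

namespace Literature.NumberTheory.LFunctions.Zhang2022.Skeleton

open Typed.AppendixB (vkSum)

/-- **`Lemma151ChiRE e1pp c′` from (B.1), (B.2), the μ = 2, 3 evaluations (rate α₁), the μ = 1
truncated evaluation at value `e1jE e1pp j = e′₁ⱼ − e1pp j` (rate α₁) and the factorisation step** —
`lemma151ChiR_of_partsR_gen` at `E1 := e1jE e1pp` (the body of `Lemma151ChiRE` unfolds `frakeE`).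
At `e1pp := AppendixB.e1ppD` the μ = 1 input is `StepB_u012R` + the derived (B.3) tail
`AppendixBTailB3Value.tailB3_sub_e1ppD_of` (RT-05 chain of record).
[cite: Zhang2022LandauSiegel, §15 Lemma 15.1; App. B pp. 106–108] -/
theorem lemma151ChiRE_of_partsR (e1pp : ℕ → ℂ) (c' : ℝ)
    (hB1 : Typed.AppendixB.EqB_1 c') (hB2 : Typed.AppendixB.EqB_2 c')
    (hmu2 : ∃ C : ℝ, ForAllLarge fun D _ _ => ∀ j ∈ ({1, 2, 3} : Finset ℕ), ∀ l₁ : ℕ, 1 ≤ l₁ →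
      l₁ ∈ nset (frakq D) → (l₁ : ℝ) < bigT D → ‖vkSum c' D (vk2 D) j l₁ - e2j j‖ ≤ C * alpha1 D)
    (hmu3 : ∃ C : ℝ, ForAllLarge fun D _ _ => ∀ j ∈ ({1, 2, 3} : Finset ℕ), ∀ l₁ : ℕ, 1 ≤ l₁ →
      l₁ ∈ nset (frakq D) → (l₁ : ℝ) < bigT D → ‖vkSum c' D (vk3 D) j l₁ - e3j j‖ ≤ C * alpha1 D)
    (hmu1 : ∃ C : ℝ, ForAllLarge fun D _ _ => ∀ j ∈ ({1, 2, 3} : Finset ℕ), ∀ l₁ : ℕ, 1 ≤ l₁ →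
      l₁ ∈ nset (frakq D) → (l₁ : ℝ) < bigT D →
        ‖vkSum c' D (fun m => if (m : ℝ) < bigP D ^ (1 / 2 : ℝ) then vk1 D m else 0) j l₁ -
            e1jE e1pp j‖ ≤ C * alpha1 D)
    (hdec : ∃ C : ℝ, ForAllLarge fun D _ χ => AssumptionA D χ → ∀ j ∈ ({1, 2, 3} : Finset ℕ),
      ∀ n₁ : ℕ, n₁ ∈ nset (frakq D) → (n₁ : ℝ) < bigT D →
        ‖(∑ n ∈ (Finset.Ico 1 ⌈bigP D⌉₊).filter (fun n => Nat.Coprime n (frakq D)),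
            bcoef D (n₁ * n) * varrhoStar c' χ j n / (n : ℂ)) -
          ∑ p ∈ n₁.divisorsAntidiagonal,
            (∑ u ∈ (Finset.Ico 1 ⌈bigP D⌉₊).filter (fun n => Nat.Coprime n (frakq D)),
              ((if ((p.1 * u : ℕ) : ℝ) < bigP D ^ (1 / 2 : ℝ) then vk1 D (p.1 * u) else 0) +
                iota2 * vk2 D (p.1 * u)) * varrhoStar c' χ j u / (u : ℂ)) *
            (∑ v ∈ (Finset.Ico 1 ⌈bigP D⌉₊).filter (fun n => Nat.Coprime n (frakq D)),
              (conj iota3 * vk3 D (p.2 * v) + conj iota4 * vk2 D (p.2 * v)) *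
                varrhoStar c' χ j v / (v : ℂ))‖ ≤
          C * alpha1 D * n₁.divisors.card) :
    Lemma151ChiRE e1pp c' :=
  lemma151ChiR_of_partsR_gen c' (e1jE e1pp) hB1 hB2 hmu2 hmu3 hmu1 hdec

/-- With the tree's factorisation step plugged (`AppendixBLemma151Reduction.lemma151_hdec_rate` at the
rate α₁): `Lemma151ChiRE e1pp c′` from (B.1), (B.2) and the three one-variable evaluations only.
[cite: Zhang2022LandauSiegel, §15 Lemma 15.1; App. B pp. 106–108] -/
theorem lemma151ChiRE_of_evals (e1pp : ℕ → ℂ) (c' : ℝ)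
    (hB1 : Typed.AppendixB.EqB_1 c') (hB2 : Typed.AppendixB.EqB_2 c')
    (hmu2 : ∃ C : ℝ, ForAllLarge fun D _ _ => ∀ j ∈ ({1, 2, 3} : Finset ℕ), ∀ l₁ : ℕ, 1 ≤ l₁ →
      l₁ ∈ nset (frakq D) → (l₁ : ℝ) < bigT D → ‖vkSum c' D (vk2 D) j l₁ - e2j j‖ ≤ C * alpha1 D)
    (hmu3 : ∃ C : ℝ, ForAllLarge fun D _ _ => ∀ j ∈ ({1, 2, 3} : Finset ℕ), ∀ l₁ : ℕ, 1 ≤ l₁ →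
      l₁ ∈ nset (frakq D) → (l₁ : ℝ) < bigT D → ‖vkSum c' D (vk3 D) j l₁ - e3j j‖ ≤ C * alpha1 D)
    (hmu1 : ∃ C : ℝ, ForAllLarge fun D _ _ => ∀ j ∈ ({1, 2, 3} : Finset ℕ), ∀ l₁ : ℕ, 1 ≤ l₁ →
      l₁ ∈ nset (frakq D) → (l₁ : ℝ) < bigT D →
        ‖vkSum c' D (fun m => if (m : ℝ) < bigP D ^ (1 / 2 : ℝ) then vk1 D m else 0) j l₁ -
            e1jE e1pp j‖ ≤ C * alpha1 D) :
    Lemma151ChiRE e1pp c' :=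
  lemma151ChiRE_of_partsR e1pp c' hB1 hB2 hmu2 hmu3 hmu1
    (lemma151_hdec_rate c' alpha1 (by
      obtain ⟨D₁, h⟩ := rate_alpha1
      exact ⟨D₁, fun D hD => (h D hD).2.2⟩))

end Literature.NumberTheory.LFunctions.Zhang2022.Skeleton
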